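import Summits.HodgeConjecture.HodgeConjecture.Theorems.HLiu418E2ArchOrthHolPrep
import HarnessLib

/-!
# Crux `HLiu418`, line LD2 (re-letter #74R in-house), organ C₂at′ — brick (α): THE FRAME TORUS AT THE PLACE `w₁` ACTS ON TRANSPORTED
# HOLOMORPHIC COTANGENT CLASSES BY THE COTANGENT CHARACTER (cone model, rank 2; the «hol side» of [Liu2021, Lem. D.2 (3)])

Cell `hodgecm-mathlib`, FLOOR 0, line LD2 (socket 27458, printed stub `stub_S1b_facts` re-lettered #74R), organ C₂at′ `ArchSignAt₂'` of LD2-plan's skeleton v5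
(e8da573259aec245 :325–:356); dealer LD2-plan (g0), payer seat LD1-p02 (g0); `--supports stmt-HodgeConjecture-24832` (helper).  THEOREMS ONLY — no definition,
no instance, no notation, no `sorry`.

WHAT.  The `n = 2`, CONE-model replacement of the «`K_∞`-covariant classes `w_j = R(σh)[Φ_j]` are `Jac k x₀`-eigenvectors» step of the `n = 3` closer ★
`F0P2oCinfArchTypeAtHolds` (there: ball model, `U(2,1)`, ★ `UnitBallFrameTorus.exists_smul_x₀_eq`).  For a rank-2 hermitian datum `U(J)`, a complex place `w₁`
with `σ_{w₁}J` HERMITIAN, and TWO cone frames `𝔣 = (v₀, t₀)` (the one holomorphy is read at) and `𝔣′ = (v₀′, t₀′)` (e.g. the negative and the positive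
column of a frame matrix `C` with `Cᴴ σJ C` diagonal):
* §1 `exists_archLocal_frame_to_frame` — there is `h ∈ U = U(σ_{w₁}J)(ℂ)` with `h t₀ = α t₀′`, `h v₀ = β v₀′`, `α, β ≠ 0` (the form values of the two frames
  are real of the same signs, so real square-root scalings match them; ★ `E2DiscBoost.exists_matrix_frame_values`, ★ `E2DiscSlice.matrix_eq_of_frame` ∕
  `conjTranspose_mul_mul_eq_of_frame`, ★ `exists_archLocal_of_inverse`);
* §2 **`rightRegular_adelicSingle_torus_smul`** — for such an `h`, every holomorphic cotangent form `f ∈ holCotForms₂ 𝔣` and every `γ ∈ U` DIAGONAL IN THE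
  FRAME `𝔣′` (`γ v₀′ = q v₀′`, `γ t₀′ = a t₀′`, `q ≠ 0`): `R(ι γ) (R(ι h)[f]) = (a q⁻¹) • R(ι h)[f]` (`ι = adelicSingle w₁`) — the class `w := R(ι h)[f]`
  is an EIGENVECTOR of the torus of the frame `𝔣′` with the cotangent character, by the cotangent law on classes (★ `E2ArchOrthHolPrep.rightRegular_adelicSingle_mul`
  at `(u, κ) = (h, h⁻¹ γ h)`, `κ v₀ = q v₀`, `κ t₀ = a t₀ + 0·v₀`).
Orientation-free (no `t`, no sign is read here); the consumer C₂at′ feeds `𝔣′ :=` (negative column, positive column) of the letter's frame at `ι`, where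
negativity for `H♮` of the `(tH)♮`-negative column is exactly the orientation binder `0 < Re ι(t)`.
HONEST LABEL: HC_CM is proved only modulo the 7 printed citations (2 remaining: hLiu418 = stmt-HodgeConjecture-24832, h413 = stmt-HodgeConjecture-24833) until
rung 0 closes; this file discharges none of them.

## References
* [Liu2021] Y. Liu, Camb. J. Math. 9 (2021) = arXiv:2102.11518: App. D Lem. D.2 (3) (p. 127–128); proof of Prop. 4.13 Case 1 (l. 2137–2141, p. 48).
* [Borel1997] A. Borel, *Automorphic forms on SL₂(ℝ)* (1997), §5.13–§5.14 (the `K`-type of a form read on the group).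
* [Jacobson] N. Jacobson, *Basic Algebra I*, Ch. V §7 pp. 150–151, §11 p. 162 (hermitian forms, unitary groups, Witt).
* [KonnoKonno2007] K. Konno, T. Konno, Thm. 5.4 (the `K`-types of the oscillator representation of `U(p,q)`).
-/

set_option autoImplicit false
-- the mandated namespace has the single-problem summit's repeated segment (`HodgeConjecture.HodgeConjecture`)
set_option linter.dupNamespace false

noncomputable section

open Matrix MeasureTheory NumberField NumberField.InfinitePlace
open scoped Matrix ComplexConjugate ComplexOrder
open Literature.NumberTheory.Automorphic Literature.NumberTheory.Automorphic.UnitaryGroup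
open Literature.NumberTheory.Automorphic.UnitaryGroup.CotangentForms (toQuotFun)
open Literature.NumberTheory.Automorphic.UnitaryCurveForms
open Literature.AlgebraicGeometry.ShimuraVarieties Literature.AlgebraicGeometry.ShimuraVarieties.UnitaryCurveCone
open Summit.HodgeConjecture.HodgeConjecture.Cruxes.HLiu418.E2DiscSlice
open Summit.HodgeConjecture.HodgeConjecture.Cruxes.HLiu418.E2DiscBoost
open Summit.HodgeConjecture.HodgeConjecture.Cruxes.HLiu418.E2ArchOrthHolPrep

namespace Summit.HodgeConjecture.HodgeConjecture.Cruxes.HLiu418.F0LD2ConeTorusCovariance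

variable {F E : Type} [Field F] [NumberField F] [Field E] [NumberField E] [Algebra F E]
  {c : E ≃ₐ[F] E} {J : Matrix (Fin 2) (Fin 2) E}
  {hc : c ≠ 1} {hfix : ∀ w : InfinitePlace E, c • w = w} {w₁ : {w : InfinitePlace E // IsComplex w}}

/-! ## §1 A unitary element carrying one cone frame onto (scalar multiples of) another -/

omit [NumberField F] [NumberField E] in
/-- **Frame to frame**: for two cone frames `𝔣`, `𝔣′` of a HERMITIAN `σ_{w₁}J` there is `h ∈ U(σ_{w₁}J)(ℂ)` and scalars `α, β ≠ 0` with `h t₀ = α t₀′`,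
`h v₀ = β v₀′` — real square-root scalings match the (real, like-signed) form values `⟪t₀,t₀⟫ ↦ ⟪t₀′,t₀′⟫ > 0`, `⟪v₀,v₀⟫ ↦ ⟪v₀′,v₀′⟫ < 0`, and a map taking
an orthogonal frame to an orthogonal frame with the same form values is unitary. [cite: Jacobson, Ch. V §7 pp. 150–151; §11 p. 162] -/
theorem exists_archLocal_frame_to_frame (hJ : (J.map w₁.1.embedding).IsHermitian) (𝔣 𝔣' : ConeFrame E J w₁) :
    ∃ (h : archLocal E 2 J w₁) (α β : ℂ), α ≠ 0 ∧ β ≠ 0 ∧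
      ((h : GL (Fin 2) ℂ) : Matrix (Fin 2) (Fin 2) ℂ) *ᵥ 𝔣.t₀ = α • 𝔣'.t₀ ∧
      ((h : GL (Fin 2) ℂ) : Matrix (Fin 2) (Fin 2) ℂ) *ᵥ 𝔣.v₀ = β • 𝔣'.v₀ := by
  have hvt : star 𝔣.v₀ ⬝ᵥ (J.map w₁.1.embedding *ᵥ 𝔣.t₀) = 0 := form_v₀_t₀ 𝔣 hJ
  have hvt' : star 𝔣'.v₀ ⬝ᵥ (J.map w₁.1.embedding *ᵥ 𝔣'.t₀) = 0 := form_v₀_t₀ 𝔣' hJ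
  -- the four (real) form values
  set Tt : ℂ := star 𝔣.t₀ ⬝ᵥ (J.map w₁.1.embedding *ᵥ 𝔣.t₀) with hTt
  set Tt' : ℂ := star 𝔣'.t₀ ⬝ᵥ (J.map w₁.1.embedding *ᵥ 𝔣'.t₀) with hTt'
  set Vv : ℂ := star 𝔣.v₀ ⬝ᵥ (J.map w₁.1.embedding *ᵥ 𝔣.v₀) with hVv
  set Vv' : ℂ := star 𝔣'.v₀ ⬝ᵥ (J.map w₁.1.embedding *ᵥ 𝔣'.v₀) with hVv'
  have hTtre : Tt = ((Tt.re : ℝ) : ℂ) := dotProduct_mulVec_self_eq_re hJ _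
  have hTt're : Tt' = ((Tt'.re : ℝ) : ℂ) := dotProduct_mulVec_self_eq_re hJ _
  have hVvre : Vv = ((Vv.re : ℝ) : ℂ) := dotProduct_mulVec_self_eq_re hJ _
  have hVv're : Vv' = ((Vv'.re : ℝ) : ℂ) := dotProduct_mulVec_self_eq_re hJ _
  have hTpos : 0 < Tt.re := 𝔣.t₀_pos
  have hT'pos : 0 < Tt'.re := 𝔣'.t₀_pos
  have hVneg : Vv.re < 0 := mem_negCone_iff.1 𝔣.v₀_mem
  have hV'neg : Vv'.re < 0 := mem_negCone_iff.1 𝔣'.v₀_mem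
  -- the real scalings
  set rα : ℝ := Real.sqrt (Tt.re / Tt'.re) with hrα
  set rβ : ℝ := Real.sqrt (Vv.re / Vv'.re) with hrβ
  have hrα2 : rα ^ 2 = Tt.re / Tt'.re := Real.sq_sqrt (div_pos hTpos hT'pos).le
  have hrβ2 : rβ ^ 2 = Vv.re / Vv'.re := Real.sq_sqrt (div_pos_of_neg_of_neg hVneg hV'neg).le
  have hrα0 : rα ≠ 0 := (Real.sqrt_pos.mpr (div_pos hTpos hT'pos)).ne'
  have hrβ0 : rβ ≠ 0 := (Real.sqrt_pos.mpr (div_pos_of_neg_of_neg hVneg hV'neg)).ne'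
  set α : ℂ := (rα : ℂ) with hα
  set β : ℂ := (rβ : ℂ) with hβ
  have hα0 : α ≠ 0 := Complex.ofReal_ne_zero.mpr hrα0
  have hβ0 : β ≠ 0 := Complex.ofReal_ne_zero.mpr hrβ0
  have hαα : starRingEnd ℂ α * α * Tt' = Tt := by
    have e1 : starRingEnd ℂ α * α = ((Tt.re / Tt'.re : ℝ) : ℂ) := by rw [hα, Complex.conj_ofReal, ← Complex.ofReal_mul, ← sq, hrα2]
    have e2 := congrArg (fun z : ℂ => ((Tt.re / Tt'.re : ℝ) : ℂ) * z) hTt're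
    rw [e1]
    refine e2.trans ?_
    rw [← Complex.ofReal_mul, div_mul_cancel₀ _ hT'pos.ne']
    exact hTtre.symm
  have hββ : starRingEnd ℂ β * β * Vv' = Vv := by
    have e1 : starRingEnd ℂ β * β = ((Vv.re / Vv'.re : ℝ) : ℂ) := by rw [hβ, Complex.conj_ofReal, ← Complex.ofReal_mul, ← sq, hrβ2]
    have e2 := congrArg (fun z : ℂ => ((Vv.re / Vv'.re : ℝ) : ℂ) * z) hVv're
    rw [e1]
    refine e2.trans ?_
    rw [← Complex.ofReal_mul, div_mul_cancel₀ _ hV'neg.ne]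
    exact hVvre.symm
  -- the matrix and its inverse by prescribed frame values
  obtain ⟨K, hKt, hKv⟩ := exists_matrix_frame_values 𝔣 hvt (α • 𝔣'.t₀) (β • 𝔣'.v₀)
  obtain ⟨K', hK't, hK'v⟩ := exists_matrix_frame_values 𝔣' hvt' (α⁻¹ • 𝔣.t₀) (β⁻¹ • 𝔣.v₀)
  have h1 : K * K' = 1 := matrix_eq_of_frame 𝔣' hvt'
    (by rw [← mulVec_mulVec, hK't, mulVec_smul, hKt, smul_smul, inv_mul_cancel₀ hα0, one_smul, one_mulVec])
    (by rw [← mulVec_mulVec, hK'v, mulVec_smul, hKv, smul_smul, inv_mul_cancel₀ hβ0, one_smul, one_mulVec])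
  have h2 : K' * K = 1 := matrix_eq_of_frame 𝔣 hvt
    (by rw [← mulVec_mulVec, hKt, mulVec_smul, hK't, smul_smul, mul_inv_cancel₀ hα0, one_smul, one_mulVec])
    (by rw [← mulVec_mulVec, hKv, mulVec_smul, hK'v, smul_smul, mul_inv_cancel₀ hβ0, one_smul, one_mulVec])
  have hu : Kᴴ * J.map w₁.1.embedding * K = J.map w₁.1.embedding := by
    refine conjTranspose_mul_mul_eq_of_frame 𝔣 hvt ?_ ?_ ?_ ?_
    · rw [hKt, star_smul, smul_dotProduct, mulVec_smul, dotProduct_smul, smul_eq_mul, smul_eq_mul, ← mul_assoc, Complex.star_def, hαα]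
    · rw [hKt, hKv, star_smul, smul_dotProduct, mulVec_smul, dotProduct_smul, 𝔣'.orth, smul_zero, smul_zero]
    · rw [hKt, hKv, star_smul, smul_dotProduct, mulVec_smul, dotProduct_smul, hvt', smul_zero, smul_zero]
    · rw [hKv, star_smul, smul_dotProduct, mulVec_smul, dotProduct_smul, smul_eq_mul, smul_eq_mul, ← mul_assoc, Complex.star_def, hββ]
  obtain ⟨h, hh⟩ := exists_archLocal_of_inverse (w₁ := w₁) h1 h2 hu
  exact ⟨h, α, β, hα0, hβ0, by rw [hh, hKt], by rw [hh, hKv]⟩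

/-! ## §2 The torus of the second frame acts on the transported class by the cotangent character -/

section Classes

variable {𝔣 : ConeFrame E J w₁}
  {μ : Measure (adelicGroupData F E c 2 J).automorphicQuotient} [(adelicGroupData F E c 2 J).IsAutomorphicMeasure μ]
  [CompactSpace (adelicGroupData F E c 2 J).automorphicQuotient]

/-- **THE FRAME TORUS ACTS BY THE COTANGENT CHARACTER ON `R(ι h)[f]`.**  Let `f ∈ holCotForms₂ 𝔣`, let `h ∈ U` carry the frame `𝔣` onto scalar multiples
of a frame `𝔣′` (`h t₀ = α t₀′`, `h v₀ = β v₀′`, `α, β ≠ 0`; §1), and let `γ ∈ U` be DIAGONAL in the frame `𝔣′`: `γ v₀′ = q v₀′` (`q ≠ 0`), `γ t₀′ = a t₀′`.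
Then `R(ι γ) (R(ι h)[f]) = (a q⁻¹) • R(ι h)[f]`, `ι = adelicSingle w₁`: the transported class is an eigenvector of the torus of `𝔣′` with the cotangent
character — `κ := h⁻¹ γ h` stabilises the line `ℂ v₀` with frame coordinates `(q, a, 0)`, and ★ `rightRegular_adelicSingle_mul` at `(h, κ)`.
[cite: Borel1997, §5.13–§5.14] [cite: Liu2021, App. D Lem. D.2 (3) (p. 127–128)] [cite: KonnoKonno2007, Thm. 5.4] -/
theorem rightRegular_adelicSingle_torus_smul {f : (adelicGroupData F E c 2 J).Adelic → ℂ} (hf : f ∈ holCotForms₂ F E c J hc hfix w₁ 𝔣)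
    (hfm : MemLp (toQuotFun (adelicGroupData F E c 2 J) f) 2 μ) (𝔣' : ConeFrame E J w₁) (h γ : archLocal E 2 J w₁) {α β q a : ℂ}
    (hα : α ≠ 0) (hβ : β ≠ 0) (hq : q ≠ 0)
    (hht : ((h : GL (Fin 2) ℂ) : Matrix (Fin 2) (Fin 2) ℂ) *ᵥ 𝔣.t₀ = α • 𝔣'.t₀)
    (hhv : ((h : GL (Fin 2) ℂ) : Matrix (Fin 2) (Fin 2) ℂ) *ᵥ 𝔣.v₀ = β • 𝔣'.v₀)
    (hγv : ((γ : GL (Fin 2) ℂ) : Matrix (Fin 2) (Fin 2) ℂ) *ᵥ 𝔣'.v₀ = q • 𝔣'.v₀)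
    (hγt : ((γ : GL (Fin 2) ℂ) : Matrix (Fin 2) (Fin 2) ℂ) *ᵥ 𝔣'.t₀ = a • 𝔣'.t₀) :
    (adelicGroupData F E c 2 J).rightRegular μ (adelicSingle F E c 2 J hc hfix w₁ γ)
        ((adelicGroupData F E c 2 J).rightRegular μ (adelicSingle F E c 2 J hc hfix w₁ h) (hfm.toLp (toQuotFun (adelicGroupData F E c 2 J) f))) =
      (a * q⁻¹) • (adelicGroupData F E c 2 J).rightRegular μ (adelicSingle F E c 2 J hc hfix w₁ h) (hfm.toLp (toQuotFun (adelicGroupData F E c 2 J) f)) := by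
  -- `κ := h⁻¹ γ h` stabilises `ℂ v₀` with coordinates `(q, a, 0)`
  set κ : archLocal E 2 J w₁ := h⁻¹ * γ * h with hκ
  have hinv : (((h⁻¹ : archLocal E 2 J w₁) : GL (Fin 2) ℂ) : Matrix (Fin 2) (Fin 2) ℂ) * ((h : GL (Fin 2) ℂ) : Matrix (Fin 2) (Fin 2) ℂ) = 1 := by
    rw [Subgroup.coe_inv, Matrix.coe_units_inv, Matrix.nonsing_inv_mul _ (Matrix.isUnits_det_units _)]
  have hinv_t : (((h⁻¹ : archLocal E 2 J w₁) : GL (Fin 2) ℂ) : Matrix (Fin 2) (Fin 2) ℂ) *ᵥ 𝔣'.t₀ = α⁻¹ • 𝔣.t₀ := by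
    have h1 : (((h⁻¹ : archLocal E 2 J w₁) : GL (Fin 2) ℂ) : Matrix (Fin 2) (Fin 2) ℂ) *ᵥ (α • 𝔣'.t₀) = 𝔣.t₀ := by
      rw [← hht, mulVec_mulVec, hinv, one_mulVec]
    rw [mulVec_smul] at h1
    rw [← h1, smul_smul, inv_mul_cancel₀ hα, one_smul]
  have hinv_v : (((h⁻¹ : archLocal E 2 J w₁) : GL (Fin 2) ℂ) : Matrix (Fin 2) (Fin 2) ℂ) *ᵥ 𝔣'.v₀ = β⁻¹ • 𝔣.v₀ := by
    have h1 : (((h⁻¹ : archLocal E 2 J w₁) : GL (Fin 2) ℂ) : Matrix (Fin 2) (Fin 2) ℂ) *ᵥ (β • 𝔣'.v₀) = 𝔣.v₀ := by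
      rw [← hhv, mulVec_mulVec, hinv, one_mulVec]
    rw [mulVec_smul] at h1
    rw [← h1, smul_smul, inv_mul_cancel₀ hβ, one_smul]
  have hκmat : ((κ : GL (Fin 2) ℂ) : Matrix (Fin 2) (Fin 2) ℂ) =
      (((h⁻¹ : archLocal E 2 J w₁) : GL (Fin 2) ℂ) : Matrix (Fin 2) (Fin 2) ℂ) * ((γ : GL (Fin 2) ℂ) : Matrix (Fin 2) (Fin 2) ℂ) *
        ((h : GL (Fin 2) ℂ) : Matrix (Fin 2) (Fin 2) ℂ) := by
    rw [hκ, Subgroup.coe_mul, Subgroup.coe_mul, Units.val_mul, Units.val_mul]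
  have hκv : ((κ : GL (Fin 2) ℂ) : Matrix (Fin 2) (Fin 2) ℂ) *ᵥ 𝔣.v₀ = q • 𝔣.v₀ := by
    rw [hκmat, ← mulVec_mulVec, ← mulVec_mulVec, hhv, mulVec_smul, hγv, mulVec_smul, mulVec_smul, hinv_v, smul_smul, smul_smul,
      mul_comm β, mul_assoc, mul_inv_cancel₀ hβ, mul_one]
  have hκt : ((κ : GL (Fin 2) ℂ) : Matrix (Fin 2) (Fin 2) ℂ) *ᵥ 𝔣.t₀ = a • 𝔣.t₀ + (0 : ℂ) • 𝔣.v₀ := by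
    rw [hκmat, ← mulVec_mulVec, ← mulVec_mulVec, hht, mulVec_smul, hγt, mulVec_smul, mulVec_smul, hinv_t, smul_smul, smul_smul,
      mul_comm α, mul_assoc, mul_inv_cancel₀ hα, mul_one, zero_smul, add_zero]
  have key := rightRegular_adelicSingle_mul (μ := μ) hf hfm h κ hq hκv hκt
  -- `h κ = γ h`
  have hhκ : h * κ = γ * h := by rw [hκ, ← mul_assoc, ← mul_assoc, mul_inv_cancel, one_mul]
  rw [hhκ, map_mul, map_mul, mul_apply_eq_comp] at key
  exact key

end Classes

end Summit.HodgeConjecture.HodgeConjecture.Cruxes.HLiu418.F0LD2ConeTorusCovariance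

end
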